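/-
Copyright (c) 2026 the pub-hodgecm-mathlib formalisation cell (harness21).  Prover seat hodgecm-mathlib-K2E4-p18 (g2),
Track B «K2-LIT» ∕ h413 (stmt-HodgeConjecture-24833), by-name brick dealt by K2E1-plan (g0) 2026-09-03T22:10:02Z:
`Theorems/K2E1HermitianDiscriminantPlaceParity.lean` — the places of `L⁺` at which the HERMITIAN DISCRIMINANT `disc Φ = det Φ`
of a non-degenerate hermitian matrix over a CM field `L` has Hilbert symbol `(disc Φ, θ)_v = −1` (`L = L⁺(√θ)`) form a FINITE set
of EVEN cardinality (Hilbert reciprocity ∕ the product formula), with the archimedean reading, the independence of the generator `θ`,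
and the invariance under change of basis `Φ ↦ ᵗ(σP) Φ P` (`disc` is a class in `(L⁺)ˣ ∕ N_{L∕L⁺}(Lˣ)`).  2026-09-03.
-/
import Mathlib.NumberTheory.NumberField.CMField
import Literature.NumberTheory.Automorphic.QuadraticHeckeCharacterCM              -- ★ `cmQuadraticGenerator` (`L = L⁺(√θ)`, `θ` totally negative)
import Literature.NumberTheory.Automorphic.QuaternionRamificationParityHolds      -- ★ `hilbertReciprocity_holds` (O'Meara 71:18)
import Literature.NumberTheory.QuadraticForms.HilbertSymbolArchimedean            -- ★ `setOf_hilbertSymbol_completion_eq_neg_one`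
import Literature.NumberTheory.QuadraticForms.HilbertReciprocityFiniteness        -- ★ `hilbertSymbol_mul_sq_right`
import Literature.NumberTheory.QuadraticForms.CyclotomicHilbertReciprocity        -- ★ `hilbertSymbol_mul_norm_left`
import Literature.NumberTheory.NumberFields.CMFieldTotallyNegativeGenerator       -- ★ `exists_mul_sq_eq_of_sq_eq`, `exists_eq_algebraMap_mul_of_complexConj_eq_neg`
import HarnessLib

/-!
# K2 (h413 = stmt-HodgeConjecture-24833), E1-adjacent brick: place parity of the hermitian discriminant

Cell `pub/hodgecm-mathlib` (D-0151), Track B (21-frontier RULING «PUSH BOTH» 2026-09-03, director req624, chair K2-lead), dealer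
K2E1-plan (g0) by-name deal 22:10:02Z to the free hand K2E4-p18 (g2): «for a non-degenerate Hermitian `Φ` on `Lⁿ` (CM `L∕L⁺`), the set
of places `v` of `L⁺` with Hilbert symbol `(disc Φ, −δ)_v = −1` is FINITE of EVEN cardinality (product formula)» — the place-count
bookkeeping that rows 19∕20 of the K2·E1 SIGS TABLE (inner forms; K2E3∕K2E1b junction) cite.  `--supports stmt-HodgeConjecture-24833`
helper; THEOREMS ONLY (no definition, no named fact, no `sorry`); everything rests on tree theorems already ★.

THE MATHEMATICS.  Let `L` be a CM field, `L⁺ = maximalRealSubfield L`, `σ` the complex conjugation, and `θ = cmQuadraticGenerator L`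
the tree's totally negative generator (`L = L⁺(√θ)`, ★ `cmQuadraticGenerator_spec`).  For `Φ ∈ Mₙ(L)` hermitian (`ᵗ(σΦ) = Φ`, the
tree's convention `(Φ.map σ)ᵀ = Φ`) the determinant is `σ`-fixed (§1 `complexConj_det`, `det_mem_maximalRealSubfield`), so
`disc Φ := det Φ ∈ L⁺`; if `Φ` is non-degenerate, `disc Φ ≠ 0`.  Landherr's local invariant of the hermitian space `(Lⁿ, Φ)` at a
place `v` of `L⁺` is the Hilbert symbol `(disc Φ, θ)_v ∈ {±1}` (`+1` iff `disc Φ` is a norm from `L ⊗ L⁺_v`), and HILBERT'S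
RECIPROCITY LAW (O'Meara 71:18, ★ `hilbertReciprocity_holds`) says: the finite places with symbol `−1` form a finite set, and the
total number of places (finite and infinite) with symbol `−1` is even (§2 `hermitianDiscriminantPlaceParity`).  Since `θ < 0` at
every (real) place `w` of `L⁺`, `(disc Φ, θ)_w = −1` iff `w(disc Φ) < 0` (§2 `setOf_infinitePlace_symbol_eq_neg_one_eq`), whence
`#{v ∤ ∞ : (disc Φ, θ)_v = −1} + #{w ∣ ∞ : w(det Φ) < 0}` is even (§2 `even_ncard_finite_add_ncard_embedding_det_lt_zero`).
§3: the symbol does not depend on the choice of generator — for any `δ ∈ L` with `σδ = −δ ≠ 0`, `δ² = d′ ∈ L⁺`, `(x, d′)_F = (x, θ)_F`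
over every field `F ⊇ L⁺` (`d′ ∈ θ·(L⁺)ײ`, ★ `exists_mul_sq_eq_of_sq_eq`) — and not on the basis: for `P ∈ GLₙ(L)`,
`det(ᵗ(σP) Φ P) = N_{L∕L⁺}(det P) · det Φ` with `N(z) = a² − θ b²` (`z = a + b√θ`), and `(x·(a² − θ b²), θ)_F = (x, θ)_F`
(★ `hilbertSymbol_mul_norm_left`), so every statement of §2 is an invariant of the hermitian space.

WHAT IS NOT HERE.  The identification `(disc Φ, θ)_v = −1 ⟺ U(Φ)(L⁺_v)` is the non-quasi-split inner form (odd `n`: never;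
even `n`: Landherr's classification) — that is the local classification of hermitian forms, a separate file if a row needs it;
for `n = 2` it is ★ `Liu2021.LemD1OfPlace.not_isIsotropic_standingData_iff_hilbertSymbol_eq_neg_one`.

Related tree currency (not restated): ★ `Liu2021.LemD1OfPlace.even_ncard_not_isIsotropic_add_ncard_pos` (the rank-2 diagonal case, in
isotropy language), ★ `K2E4KottwitzSignParity.kottwitzSignParity` (its use at a semiregular `γ₀ ∈ U(3)`), ★
`Deligne1982/WeilTypeCMDiscriminant` (the class `disc φ ∈ F^×∕Nm(E^×)` on real carriers of abelian varieties of Weil type).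

HONEST LABEL: HC_CM is proved only modulo the 7 printed citations (2 remaining named inputs: hLiu418 = stmt-HodgeConjecture-24832, h413 =
stmt-HodgeConjecture-24833) until rung 0 closes; this file is a `--supports stmt-HodgeConjecture-24833` helper and retires nothing by itself.

## References
* [Omeara1963] O. T. O'Meara, *Introduction to Quadratic Forms*, Grundlehren 117 (1963), §63B (Hilbert symbol), §71 Thm. 71:18
  (Hilbert reciprocity `∏_𝔭 (a, b)_𝔭 = 1`).
* [Landherr1936HermitianForms] W. Landherr, *Äquivalenz Hermitescher Formen über einem beliebigen algebraischen Zahlkörper*, Abh. Math.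
  Sem. Hamburg 11 (1936) 245–248 (rank, discriminant class in `F^×∕N(E^×)`, signatures; local invariant `(disc, θ)_v`).
* [Scharlau1985HermitianForms] W. Scharlau, *Quadratic and Hermitian Forms*, Grundlehren 270 (1985), Ch. 10 §1 (hermitian forms over
  quadratic extensions; Jacobson's trace-form reduction, Example 1.6).
* [Rogawski1990] J. D. Rogawski, *Automorphic Representations of Unitary Groups in Three Variables*, Ann. of Math. Stud. 123 (1990),
  §14.5 p. 239 (inner forms of unitary groups via hermitian spaces), §8.1 p. 117 (Kottwitz signs).
-/

set_option autoImplicit false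
-- the mandated namespace repeats the single-problem summit's segment (`HodgeConjecture.HodgeConjecture`)
set_option linter.dupNamespace false

noncomputable section

open scoped Matrix
open NumberField IsDedekindDomain
open Literature.NumberTheory.QuadraticForms (hilbertSymbol hilbertReciprocity_holds hilbertSymbol_mul_sq_right
  hilbertSymbol_mul_norm_left setOf_hilbertSymbol_completion_eq_neg_one)
open Literature.NumberTheory.Automorphic (cmQuadraticGenerator cmQuadraticGenerator_spec not_isSquare_cmQuadraticGenerator
  embedding_cmQuadraticGenerator_lt_zero')
open Literature.NumberTheory.NumberFields (exists_mul_sq_eq_of_sq_eq exists_eq_algebraMap_mul_of_complexConj_eq_neg)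

namespace Summit.HodgeConjecture.HodgeConjecture.Cruxes.H413.K2E1HermitianDiscriminantPlaceParity

/-! ## §0 Hilbert reciprocity with a totally negative second argument (any number field) -/

section TotallyNegative

variable {K : Type} [Field K] [NumberField K]

omit [NumberField K] in
/-- **Archimedean reading**: if `θ` is negative at every real place of `K`, then for `a ≠ 0` the infinite places `w` with
`(a, θ)_w = −1` are exactly the real places at which `a` is negative (`(a, θ)_ℝ = −1 ⟺ a < 0 ∧ θ < 0`; complex places never).
[cite: Omeara1963, §63B] -/
theorem setOf_infinitePlace_symbol_eq_neg_one_eq_of_neg {a θ : K} (ha : a ≠ 0) (hθ : θ ≠ 0)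
    (hθneg : ∀ (w : InfinitePlace K) (hw : w.IsReal), InfinitePlace.embedding_of_isReal hw θ < 0) :
    {w : InfinitePlace K | hilbertSymbol w.Completion (algebraMap K _ a) (algebraMap K _ θ) = -1} =
      {w : InfinitePlace K | ∃ hw : w.IsReal, InfinitePlace.embedding_of_isReal hw a < 0} := by
  rw [setOf_hilbertSymbol_completion_eq_neg_one ha hθ]
  ext w
  simp only [Set.mem_setOf_eq]
  exact ⟨fun ⟨hw, h, _⟩ => ⟨hw, h⟩, fun ⟨hw, h⟩ => ⟨hw, h, hθneg w hw⟩⟩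

/-- **Hilbert reciprocity with a totally negative partner**: for `a θ ≠ 0` in a number field `K` with `θ` negative at every real
place, the finite places `v` with `(a, θ)_v = −1` form a finite set, and their number plus the number of real places at which `a` is
negative is EVEN. [cite: Omeara1963, §71 Thm. 71:18] -/
theorem finite_and_even_ncard_add_ncard_neg_of_neg {a θ : K} (ha : a ≠ 0) (hθ : θ ≠ 0)
    (hθneg : ∀ (w : InfinitePlace K) (hw : w.IsReal), InfinitePlace.embedding_of_isReal hw θ < 0) :
    {v : HeightOneSpectrum (𝓞 K) | hilbertSymbol (v.adicCompletion K) (algebraMap K _ a) (algebraMap K _ θ) = -1}.Finite ∧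
      Even ({v : HeightOneSpectrum (𝓞 K) |
                hilbertSymbol (v.adicCompletion K) (algebraMap K _ a) (algebraMap K _ θ) = -1}.ncard +
            {w : InfinitePlace K | ∃ hw : w.IsReal, InfinitePlace.embedding_of_isReal hw a < 0}.ncard) := by
  rw [← setOf_infinitePlace_symbol_eq_neg_one_eq_of_neg ha hθ hθneg]
  exact hilbertReciprocity_holds K a θ ha hθ

end TotallyNegative

/-! ## §1 The hermitian discriminant `det Φ` lies in `L⁺` -/

section CM

variable (L : Type) [Field L] [NumberField L] [IsCMField L]

/-- **`σ (det Φ) = det Φ` for a hermitian matrix** `Φ` over the CM field `L` (`ᵗ(σΦ) = Φ`): `σ(det Φ) = det(σΦ) = det ᵗ(σΦ) = det Φ`.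
[cite: Scharlau1985HermitianForms, Ch. 10 §1] -/
theorem complexConj_det {n : ℕ} {Φ : Matrix (Fin n) (Fin n) L} (hΦ : (Φ.map (IsCMField.complexConj L))ᵀ = Φ) :
    IsCMField.complexConj L Φ.det = Φ.det := by
  conv_rhs => rw [← hΦ]
  rw [Matrix.det_transpose, AlgEquiv.map_det, AlgEquiv.mapMatrix_apply]

/-- **The hermitian discriminant is `L⁺`-rational**: `det Φ ∈ L⁺ = maximalRealSubfield L` for `Φ` hermitian (Landherr's `disc Φ ∈ F`).
[cite: Landherr1936HermitianForms] -/
theorem det_mem_maximalRealSubfield {n : ℕ} {Φ : Matrix (Fin n) (Fin n) L} (hΦ : (Φ.map (IsCMField.complexConj L))ᵀ = Φ) :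
    Φ.det ∈ maximalRealSubfield L :=
  (IsCMField.complexConj_eq_self_iff L Φ.det).1 (complexConj_det L hΦ)

/-- … packaged as an element: `∃ d : L⁺, d = det Φ` in `L`, and `d ≠ 0` when `Φ` is non-degenerate. [cite: Landherr1936HermitianForms] -/
theorem exists_coe_eq_det {n : ℕ} {Φ : Matrix (Fin n) (Fin n) L} (hΦ : (Φ.map (IsCMField.complexConj L))ᵀ = Φ) (hdet : Φ.det ≠ 0) :
    ∃ d : maximalRealSubfield L, (d : L) = Φ.det ∧ d ≠ 0 :=
  ⟨⟨Φ.det, det_mem_maximalRealSubfield L hΦ⟩, rfl, fun h => hdet (by simpa using congrArg Subtype.val h)⟩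

/-! ## §2 Place parity of `(disc Φ, θ)` over `L⁺` -/

/-- `θ = cmQuadraticGenerator L ≠ 0` in `L⁺` (it is a non-square). [folklore] -/
theorem cmQuadraticGenerator_ne_zero : (cmQuadraticGenerator L : maximalRealSubfield L) ≠ 0 := fun h =>
  not_isSquare_cmQuadraticGenerator L (h ▸ IsSquare.zero)

/-- **PLACE PARITY OF THE HERMITIAN DISCRIMINANT** (Hilbert reciprocity for `(disc Φ, θ)` over `L⁺`, `L = L⁺(√θ)`): for a CM field `L`,
`θ = cmQuadraticGenerator L`, and `d ∈ L⁺` non-zero — in particular `d = disc Φ = det Φ` of a NON-DEGENERATE HERMITIAN `Φ ∈ Mₙ(L)`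
(`exists_coe_eq_det`) — the set of finite places `v` of `L⁺` with `(d, θ)_v = −1` (computed in `L⁺_v`) is FINITE, and the number of
ALL places of `L⁺` (finite `v`, and infinite `w`, symbol computed in `(L⁺)_w ≅ ℝ`) with `(d, θ) = −1` is EVEN.  These are the places at
which `d` is not a local norm from `L`, i.e. (Landherr) at which the hermitian space `(Lⁿ, Φ)` has non-trivial local invariant.
[cite: Omeara1963, §71 Thm. 71:18] [cite: Landherr1936HermitianForms] -/
theorem hermitianDiscriminantPlaceParity (d : maximalRealSubfield L) (hd : d ≠ 0) :
    {v : HeightOneSpectrum (𝓞 (maximalRealSubfield L)) |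
        hilbertSymbol (v.adicCompletion (maximalRealSubfield L)) (algebraMap (maximalRealSubfield L) _ d)
          (algebraMap (maximalRealSubfield L) _ (cmQuadraticGenerator L : maximalRealSubfield L)) = -1}.Finite ∧
      Even ({v : HeightOneSpectrum (𝓞 (maximalRealSubfield L)) |
                hilbertSymbol (v.adicCompletion (maximalRealSubfield L)) (algebraMap (maximalRealSubfield L) _ d)
                  (algebraMap (maximalRealSubfield L) _ (cmQuadraticGenerator L : maximalRealSubfield L)) = -1}.ncard +
            {w : InfinitePlace (maximalRealSubfield L) |
                hilbertSymbol w.Completion (algebraMap (maximalRealSubfield L) _ d)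
                  (algebraMap (maximalRealSubfield L) _ (cmQuadraticGenerator L : maximalRealSubfield L)) = -1}.ncard) :=
  hilbertReciprocity_holds (maximalRealSubfield L) d _ hd (cmQuadraticGenerator_ne_zero L)

/-- **Archimedean reading**: `θ` is totally negative, so the infinite places of `L⁺` with `(d, θ)_w = −1` are exactly those (real) `w` at
which `d` is NEGATIVE (for `d = det Φ`: the places where the signature `(p_w, q_w)` of `Φ` has `q_w` odd). [cite: Omeara1963, §63B] -/
theorem setOf_infinitePlace_symbol_eq_neg_one_eq (d : maximalRealSubfield L) (hd : d ≠ 0) :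
    {w : InfinitePlace (maximalRealSubfield L) |
        hilbertSymbol w.Completion (algebraMap (maximalRealSubfield L) _ d)
          (algebraMap (maximalRealSubfield L) _ (cmQuadraticGenerator L : maximalRealSubfield L)) = -1} =
      {w : InfinitePlace (maximalRealSubfield L) | ∃ hw : w.IsReal, InfinitePlace.embedding_of_isReal hw d < 0} :=
  setOf_infinitePlace_symbol_eq_neg_one_eq_of_neg hd (cmQuadraticGenerator_ne_zero L) (embedding_cmQuadraticGenerator_lt_zero' L)

/-- **The parity in signature form**: `#{v ∤ ∞ : (d, θ)_v = −1} + #{w ∣ ∞ : w(d) < 0}` is EVEN, and the first set is finite — for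
`d = det Φ` of a non-degenerate hermitian `Φ`: the finite places where `disc Φ` is not a local norm, plus the real places where `det Φ < 0`,
are even in number. [cite: Omeara1963, §71 Thm. 71:18] [cite: Landherr1936HermitianForms] -/
theorem even_ncard_finite_add_ncard_embedding_lt_zero (d : maximalRealSubfield L) (hd : d ≠ 0) :
    {v : HeightOneSpectrum (𝓞 (maximalRealSubfield L)) |
        hilbertSymbol (v.adicCompletion (maximalRealSubfield L)) (algebraMap (maximalRealSubfield L) _ d)
          (algebraMap (maximalRealSubfield L) _ (cmQuadraticGenerator L : maximalRealSubfield L)) = -1}.Finite ∧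
      Even ({v : HeightOneSpectrum (𝓞 (maximalRealSubfield L)) |
                hilbertSymbol (v.adicCompletion (maximalRealSubfield L)) (algebraMap (maximalRealSubfield L) _ d)
                  (algebraMap (maximalRealSubfield L) _ (cmQuadraticGenerator L : maximalRealSubfield L)) = -1}.ncard +
            {w : InfinitePlace (maximalRealSubfield L) | ∃ hw : w.IsReal, InfinitePlace.embedding_of_isReal hw d < 0}.ncard) :=
  finite_and_even_ncard_add_ncard_neg_of_neg hd (cmQuadraticGenerator_ne_zero L) (embedding_cmQuadraticGenerator_lt_zero' L)

/-- **The dealt statement, verbatim shape** — for a NON-DEGENERATE HERMITIAN `Φ ∈ Mₙ(L)`: there is `d ∈ L⁺` with `d = det Φ` (the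
hermitian discriminant), and the finite places `v` of `L⁺` with `(det Φ, θ)_v = −1` are finite in number, of total (finite + infinite)
EVEN cardinality. [cite: Omeara1963, §71 Thm. 71:18] [cite: Landherr1936HermitianForms] -/
theorem hermitianDiscriminantPlaceParity_of_isHermitian {n : ℕ} (Φ : Matrix (Fin n) (Fin n) L)
    (hΦ : (Φ.map (IsCMField.complexConj L))ᵀ = Φ) (hdet : Φ.det ≠ 0) :
    ∃ d : maximalRealSubfield L, (d : L) = Φ.det ∧ d ≠ 0 ∧
      {v : HeightOneSpectrum (𝓞 (maximalRealSubfield L)) |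
          hilbertSymbol (v.adicCompletion (maximalRealSubfield L)) (algebraMap (maximalRealSubfield L) _ d)
            (algebraMap (maximalRealSubfield L) _ (cmQuadraticGenerator L : maximalRealSubfield L)) = -1}.Finite ∧
      Even ({v : HeightOneSpectrum (𝓞 (maximalRealSubfield L)) |
                hilbertSymbol (v.adicCompletion (maximalRealSubfield L)) (algebraMap (maximalRealSubfield L) _ d)
                  (algebraMap (maximalRealSubfield L) _ (cmQuadraticGenerator L : maximalRealSubfield L)) = -1}.ncard +
            {w : InfinitePlace (maximalRealSubfield L) |
                hilbertSymbol w.Completion (algebraMap (maximalRealSubfield L) _ d)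
                  (algebraMap (maximalRealSubfield L) _ (cmQuadraticGenerator L : maximalRealSubfield L)) = -1}.ncard) := by
  obtain ⟨d, hdL, hd⟩ := exists_coe_eq_det L hΦ hdet
  exact ⟨d, hdL, hd, hermitianDiscriminantPlaceParity L d hd⟩

/-! ## §3 Invariance: the generator and the basis -/

/-- **Independence of the generator**: if `δ ∈ L` is purely imaginary (`σδ = −δ`), non-zero, with `δ² = d′ ∈ L⁺` (so `L = L⁺(δ)` as
well), then `d′ ∈ θ · (L⁺)ײ` and the Hilbert symbols with `d′` and with `θ = cmQuadraticGenerator L` agree over EVERY field `F ⊇ L⁺`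
(completions included): `(x, d′)_F = (x, θ)_F`. [cite: Omeara1963, §63B] -/
theorem hilbertSymbol_eq_of_sq_eq {δ : L} (hδ : IsCMField.complexConj L δ = -δ) (hδ0 : δ ≠ 0) {d' : maximalRealSubfield L}
    (hd' : δ ^ 2 = algebraMap (maximalRealSubfield L) L d') (F : Type*) [Field F] [Algebra (maximalRealSubfield L) F]
    (x : maximalRealSubfield L) :
    hilbertSymbol F (algebraMap (maximalRealSubfield L) F x) (algebraMap (maximalRealSubfield L) F d') =
      hilbertSymbol F (algebraMap (maximalRealSubfield L) F x)
        (algebraMap (maximalRealSubfield L) F (cmQuadraticGenerator L : maximalRealSubfield L)) := by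
  obtain ⟨α, hα0, hα, hαsq⟩ := cmQuadraticGenerator_spec L
  obtain ⟨r, hr⟩ := exists_mul_sq_eq_of_sq_eq hα hα0 hδ hαsq hd'
  have hr0 : r ≠ 0 := by
    rintro rfl
    rw [zero_pow two_ne_zero, mul_zero] at hr
    rw [hr, map_zero, sq_eq_zero_iff] at hd'
    exact hδ0 hd'
  rw [hr, map_mul, map_pow]
  exact hilbertSymbol_mul_sq_right _ _ ((map_ne_zero_iff _ (algebraMap (maximalRealSubfield L) F).injective).2 hr0)

/-- **Every element of `L` is `a + b·α`** with `a, b ∈ L⁺`, for a fixed non-zero purely imaginary `α` (`σα = −α`): `a = (z + σz)∕2`,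
`b·α = (z − σz)∕2`. [folklore] -/
theorem exists_eq_add_mul {α : L} (hα : IsCMField.complexConj L α = -α) (hα0 : α ≠ 0) (z : L) :
    ∃ a b : maximalRealSubfield L,
      z = algebraMap (maximalRealSubfield L) L a + algebraMap (maximalRealSubfield L) L b * α := by
  have ha : (z + IsCMField.complexConj L z) / 2 ∈ maximalRealSubfield L := by
    rw [← IsCMField.complexConj_eq_self_iff, map_div₀, map_add, IsCMField.complexConj_apply_apply, map_ofNat, add_comm]
  have hc : IsCMField.complexConj L ((z - IsCMField.complexConj L z) / 2) = -((z - IsCMField.complexConj L z) / 2) := by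
    rw [map_div₀, map_sub, IsCMField.complexConj_apply_apply, map_ofNat]
    ring
  obtain ⟨b, hb⟩ := exists_eq_algebraMap_mul_of_complexConj_eq_neg hα hα0 hc
  refine ⟨⟨_, ha⟩, b, ?_⟩
  rw [← hb]
  change z = (z + IsCMField.complexConj L z) / 2 + (z - IsCMField.complexConj L z) / 2
  ring

/-- **The norm from `L` is a value of the norm form of `θ`**: `σz · z = a² − θ b²` for `z = a + b·α`, `α² = θ`. [folklore] -/
theorem complexConj_mul_self_eq {α : L} (hα : IsCMField.complexConj L α = -α) {θ : maximalRealSubfield L}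
    (hθ : α ^ 2 = algebraMap (maximalRealSubfield L) L θ) (a b : maximalRealSubfield L) :
    IsCMField.complexConj L (algebraMap (maximalRealSubfield L) L a + algebraMap (maximalRealSubfield L) L b * α) *
        (algebraMap (maximalRealSubfield L) L a + algebraMap (maximalRealSubfield L) L b * α) =
      algebraMap (maximalRealSubfield L) L (a ^ 2 - θ * b ^ 2) := by
  rw [map_add, map_mul, AlgEquiv.commutes, AlgEquiv.commutes, hα, map_sub, map_mul, map_pow, map_pow, ← hθ]
  ring

/-- **Change of basis multiplies the discriminant by a norm**: for `P ∈ Mₙ(L)`, `det(ᵗ(σP) · Φ · P) = (σ(det P) · det P) · det Φ`.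
[cite: Scharlau1985HermitianForms, Ch. 10 §1] -/
theorem det_conjTranspose_mul_mul {n : ℕ} (Φ P : Matrix (Fin n) (Fin n) L) :
    ((P.map (IsCMField.complexConj L))ᵀ * Φ * P).det = IsCMField.complexConj L P.det * P.det * Φ.det := by
  rw [Matrix.det_mul, Matrix.det_mul, Matrix.det_transpose, AlgEquiv.map_det, AlgEquiv.mapMatrix_apply]
  ring

/-- **INVARIANCE OF THE LOCAL SYMBOLS UNDER CHANGE OF BASIS** (`disc Φ` is a well-defined class in `(L⁺)ˣ ∕ N_{L∕L⁺}(Lˣ)`): if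
`d, d′ ∈ L⁺` are the determinants of `Φ` and of `Φ′ = ᵗ(σP) Φ P` with `det P ≠ 0`, then `(d′, θ)_F = (d, θ)_F` over every field `F ⊇ L⁺`
of characteristic `≠ 2` — in particular at every completion of `L⁺`, so the sets and counts of §2 are the same for `Φ` and `Φ′`.
[cite: Landherr1936HermitianForms] [cite: Omeara1963, §63B] -/
theorem hilbertSymbol_det_congr {n : ℕ} {Φ P : Matrix (Fin n) (Fin n) L} (hP : P.det ≠ 0) {d d' : maximalRealSubfield L}
    (hd : (d : L) = Φ.det) (hd' : (d' : L) = ((P.map (IsCMField.complexConj L))ᵀ * Φ * P).det)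
    (F : Type*) [Field F] [NeZero (2 : F)] [Algebra (maximalRealSubfield L) F] :
    hilbertSymbol F (algebraMap (maximalRealSubfield L) F d')
        (algebraMap (maximalRealSubfield L) F (cmQuadraticGenerator L : maximalRealSubfield L)) =
      hilbertSymbol F (algebraMap (maximalRealSubfield L) F d)
        (algebraMap (maximalRealSubfield L) F (cmQuadraticGenerator L : maximalRealSubfield L)) := by
  obtain ⟨α, hα0, hα, hαsq⟩ := cmQuadraticGenerator_spec L
  obtain ⟨a, b, hab⟩ := exists_eq_add_mul L hα hα0 P.det
  -- `d′ = d · (a² − θ b²)` in `L⁺`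
  have hnorm : IsCMField.complexConj L P.det * P.det =
      algebraMap (maximalRealSubfield L) L (a ^ 2 - (cmQuadraticGenerator L : maximalRealSubfield L) * b ^ 2) := by
    rw [hab]
    exact complexConj_mul_self_eq L hα hαsq a b
  have hdd : d' = d * (a ^ 2 - (cmQuadraticGenerator L : maximalRealSubfield L) * b ^ 2) := by
    apply (algebraMap (maximalRealSubfield L) L).injective
    rw [map_mul, ← hnorm]
    change (d' : L) = (d : L) * _
    rw [hd', hd, det_conjTranspose_mul_mul]
    ring
  -- the norm `a² − θ b²` is non-zero since `det P ≠ 0`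
  have hn0 : a ^ 2 - (cmQuadraticGenerator L : maximalRealSubfield L) * b ^ 2 ≠ 0 := by
    intro h
    rw [h, map_zero, mul_eq_zero] at hnorm
    exact hnorm.elim (fun h' => hP ((map_eq_zero_iff _ (IsCMField.complexConj L).injective).1 h')) hP
  have hinj := (algebraMap (maximalRealSubfield L) F).injective
  rw [hdd, map_mul, map_sub, map_mul, map_pow, map_pow]
  exact hilbertSymbol_mul_norm_left ((map_ne_zero_iff _ hinj).2 (cmQuadraticGenerator_ne_zero L))
    (by rw [← map_pow, ← map_pow, ← map_mul, ← map_sub]; exact (map_ne_zero_iff _ hinj).2 hn0) _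

end CM

end Summit.HodgeConjecture.HodgeConjecture.Cruxes.H413.K2E1HermitianDiscriminantPlaceParity

end
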